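import Summits.CriticalPhenomena.PercolationContinuityZ3.Theorems.FK.InfiniteVolumeFiniteEnergy
import Summits.CriticalPhenomena.PercolationContinuityZ3.Theorems.FK.ConditionalEnergyGeneric
import HarnessLib

/-!
# FK-continuity transplant, FO-10 seat B (vi): CONDITIONAL two-sided finite energy and quasi-independence for the
# INFINITE-VOLUME random-cluster measures `φ^b_{p,q}` on `ℤ^d` (every box limit `IsBoxLimit d b p q P`, `q ≥ 1`)

Cell `fk-continuity` (bschramm), registry row FO-10b; support file of the FK-continuity transplant
(`--supports stmt-CriticalPhenomena-4575`, helper); builds on p205010 (kernel theorem, internal audit signed;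
external expert review pending). No definitions, no named facts, no sorries; standard axioms.

This is the instantiation, at the actual cone sites of the `q = 1` chain (product measure on `ℤ^d`: CONE-PERDECL §C
#17 `bondPercolation_inter_of_disjoint`, #19 `prodBernoulli_real_inter_of_determinedBy`, #23
`prodBernoulli_real_forall_notMem`, #24/#30 `prodBernoulli_real_subset` / `bondPercolation_real_setOf_subset`, #31
`le_bondPercolation_real_forall_notMem`), of this row's measure-generic layer `ConditionalEnergyGeneric.lean`
(namespace `….FK.Tolerance`, p244772) with row FO-06b's infinite-volume integrated tolerances
`IsBoxLimit.pow_mul_real_preimage_openEdges_le` / `IsBoxLimit.pow_mul_real_preimage_sdiff_le`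
(`InfiniteVolumeFiniteEnergy.lean`; Grimmett 2006 Thm. (4.17)(b)/(4.19) with eq. (3.4)). For a box limit `P`
(`IsBoxLimit d b p q P`, `0 ≤ p ≤ 1`, `q ≥ 1`; in particular `P = rcLimit d b p q = φ^b_{p,q}`, both `b`), an event `A`
measurable and determined by a set `K` of pairs, a finite set `F` (resp. `S`) of EDGES OF `ℤ^d` disjoint from `K`,
`T ⊆ S`, `π = p/(p + q(1-p))`:

* `IsBoxLimit.pow_mul_real_le_real_inter_subset` / `IsBoxLimit.real_inter_subset_le_pow_mul`:
  `π^{|F|} P(A) ≤ P(A ∩ {F open}) ≤ p^{|F|} P(A)`;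
* `IsBoxLimit.pow_mul_real_le_real_inter_forall_notMem` / `IsBoxLimit.real_inter_forall_notMem_le_pow_mul`:
  `(1-p)^{|F|} P(A) ≤ P(A ∩ {F closed}) ≤ (1-π)^{|F|} P(A)`;
* `IsBoxLimit.patternLower_mul_real_le` / `IsBoxLimit.real_inter_localCylinder_le`: pattern cylinders
  `π^{|T|}(1-p)^{|S∖T|} P(A) ≤ P(A ∩ [T]_S) ≤ p^{|T|}(1-π)^{|S∖T|} P(A)`;
* `IsBoxLimit.real_inter_le_pow_mul_real_mul_real` / `IsBoxLimit.real_mul_real_le_pow_mul_real_inter`: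
  QUASI-INDEPENDENCE `q^{-|S|} P(A) P(D) ≤ P(A ∩ D) ≤ q^{|S|} P(A) P(D)` for `D` determined by `S`;
* the same for the named limits `rcLimit d b p q` (`rcLimit_real_inter_le_pow_mul_real_mul_real`, …).
The cost inequalities `p ≤ qπ`, `1 - π ≤ q(1-p)` (`le_mul_div_insertionDenominator`,
`one_sub_div_insertionDenominator_le_mul`) are the only arithmetic input.

## References

* G. Grimmett, *The Random-Cluster Model*, Springer 2006: Thm. (3.1)(a) eq. (3.4) (p. 38); Thm. (4.17)(b) (p. 75);
  Thm. (4.19) (p. 77). [Grimmett2006]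
-/

noncomputable section

open MeasureTheory Set
open scoped ENNReal

namespace Summit.CriticalPhenomena.PercolationContinuityZ3.Theorems.FK

open Literature.Probability.Percolation Literature.Probability.LatticeModels

/-! ### The two cost inequalities -/

/-- `p ≤ q · π`, `π = p/(p + q(1-p))`, for `0 ≤ p ≤ 1`, `q ≥ 1`. [folklore] -/
theorem le_mul_div_insertionDenominator {p q : ℝ} (hp : p ∈ Set.Icc (0 : ℝ) 1) (hq : 1 ≤ q) :
    p ≤ q * (p / (p + q * (1 - p))) := by
  have hD := insertionDenominator_pos hp hq
  rw [mul_div_assoc', le_div_iff₀ hD]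
  nlinarith [mul_nonneg (mul_nonneg hp.1 hp.1) (sub_nonneg.2 hq)]

/-- `1 - π ≤ q · (1 - p)`, `π = p/(p + q(1-p))`, for `0 ≤ p ≤ 1`, `q ≥ 1`. [folklore] -/
theorem one_sub_div_insertionDenominator_le_mul {p q : ℝ} (hp : p ∈ Set.Icc (0 : ℝ) 1) (hq : 1 ≤ q) :
    1 - p / (p + q * (1 - p)) ≤ q * (1 - p) := by
  have hD := insertionDenominator_pos hp hq
  have h : 1 - p / (p + q * (1 - p)) = q * (1 - p) / (p + q * (1 - p)) := by
    field_simp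
    ring
  rw [h, div_le_iff₀ hD]
  have h0 : 0 ≤ q * (1 - p) := mul_nonneg (zero_le_one.trans hq) (sub_nonneg.2 hp.2)
  nlinarith [mul_nonneg h0 (mul_nonneg (sub_nonneg.2 hq) (sub_nonneg.2 hp.2))]

/-- `π = p/(p + q(1-p)) ≤ 1` for `0 ≤ p ≤ 1`, `q ≥ 1`. [folklore] -/
theorem div_insertionDenominator_le_one {p q : ℝ} (hp : p ∈ Set.Icc (0 : ℝ) 1) (hq : 1 ≤ q) :
    p / (p + q * (1 - p)) ≤ 1 :=
  (div_le_one (insertionDenominator_pos hp hq)).2 (by nlinarith [hp.1, hp.2])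

variable {d : ℕ} {b : Bool} {p q : ℝ} {P : Measure (BondConfig (Site d))} {A : Set (BondConfig (Site d))}
  {K : Set (Sym2 (Site d))}

/-! ### The two tolerances of a box limit, in the shape of the generic layer -/

/-- Insertion tolerance of a box limit on the edges of `ℤ^d`, hypothesis `hins` of `FK.Tolerance.*`.
[cite: Grimmett2006, Thm. (4.17)(b) (p. 75); Thm. (3.1)(a) eq. (3.4) (p. 38)] -/
theorem IsBoxLimit.tolerance_union (hP : IsBoxLimit d b p q P) (hp : p ∈ Set.Icc (0 : ℝ) 1) (hq : 1 ≤ q) :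
    ∀ (F : Finset (Sym2 (Site d))) (A : Set (BondConfig (Site d))), (↑F : Set (Sym2 (Site d))) ⊆ (zdGraph d).edgeSet →
      MeasurableSet A → (p / (p + q * (1 - p))) ^ F.card * P.real ((fun ω => ω ∪ ↑F) ⁻¹' A) ≤ P.real A :=
  fun _ _ hF hA => hP.pow_mul_real_preimage_openEdges_le hp hq hF hA

/-- Deletion tolerance of a box limit, hypothesis `hdel` of `FK.Tolerance.*` (true for all finite sets of pairs; restricted
to the edges of `ℤ^d` to match the shape). [cite: Grimmett2006, Thm. (4.17)(b) (p. 75); Thm. (3.1)(a) eq. (3.4) (p. 38)] -/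
theorem IsBoxLimit.tolerance_sdiff (hP : IsBoxLimit d b p q P) (hp : p ∈ Set.Icc (0 : ℝ) 1) (hq : 1 ≤ q) :
    ∀ (F : Finset (Sym2 (Site d))) (A : Set (BondConfig (Site d))), (↑F : Set (Sym2 (Site d))) ⊆ (zdGraph d).edgeSet →
      MeasurableSet A → (1 - p) ^ F.card * P.real ((fun ω => ω \ ↑F) ⁻¹' A) ≤ P.real A :=
  fun F _ _ hA => hP.pow_mul_real_preimage_sdiff_le hp hq F hA

/-! ### Conditional two-sided finite energy for `φ^b_{p,q}` -/

/-- **`π^{|F|} P(A) ≤ P(A ∩ {F open})`** for a box limit `P = φ^b_{p,q}`, `A` measurable determined by `K`, `F` a finite set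
of edges of `ℤ^d` disjoint from `K`. [cite: Grimmett2006, Thm. (4.17)(b) (p. 75); Thm. (3.1)(a) eq. (3.4) (p. 38)] -/
theorem IsBoxLimit.pow_mul_real_le_real_inter_subset (hP : IsBoxLimit d b p q P) (hp : p ∈ Set.Icc (0 : ℝ) 1)
    (hq : 1 ≤ q) (hA : DeterminedBy A K) (hAm : MeasurableSet A) {F : Finset (Sym2 (Site d))}
    (hFE : (↑F : Set (Sym2 (Site d))) ⊆ (zdGraph d).edgeSet) (hKF : ∀ e ∈ F, e ∉ K) :
    (p / (p + q * (1 - p))) ^ F.card * P.real A ≤ P.real (A ∩ {ω | (↑F : Set (Sym2 (Site d))) ⊆ ω}) :=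
  Tolerance.pow_mul_real_le_real_inter_subset P (hP.tolerance_union hp hq) hA hAm hFE hKF

/-- **`P(A ∩ {F open}) ≤ p^{|F|} P(A)`** for a box limit `P = φ^b_{p,q}`. [cite: Grimmett2006, Thm. (4.17)(b) (p. 75); Thm. (3.1)(a) eq. (3.4) (p. 38)] -/
theorem IsBoxLimit.real_inter_subset_le_pow_mul (hP : IsBoxLimit d b p q P) (hp : p ∈ Set.Icc (0 : ℝ) 1)
    (hq : 1 ≤ q) (hA : DeterminedBy A K) (hAm : MeasurableSet A) {F : Finset (Sym2 (Site d))}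
    (hFE : (↑F : Set (Sym2 (Site d))) ⊆ (zdGraph d).edgeSet) (hKF : ∀ e ∈ F, e ∉ K) :
    P.real (A ∩ {ω | (↑F : Set (Sym2 (Site d))) ⊆ ω}) ≤ p ^ F.card * P.real A := by
  haveI := hP.isProbabilityMeasure
  exact Tolerance.real_inter_subset_le_pow_mul P hp.1 (hP.tolerance_sdiff hp hq) hA hAm hFE hKF

/-- **`(1-p)^{|F|} P(A) ≤ P(A ∩ {F closed})`** for a box limit `P = φ^b_{p,q}`. [cite: Grimmett2006, Thm. (4.17)(b) (p. 75); Thm. (3.1)(a) eq. (3.4) (p. 38)] -/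
theorem IsBoxLimit.pow_mul_real_le_real_inter_forall_notMem (hP : IsBoxLimit d b p q P) (hp : p ∈ Set.Icc (0 : ℝ) 1)
    (hq : 1 ≤ q) (hA : DeterminedBy A K) (hAm : MeasurableSet A) {F : Finset (Sym2 (Site d))}
    (hFE : (↑F : Set (Sym2 (Site d))) ⊆ (zdGraph d).edgeSet) (hKF : ∀ e ∈ F, e ∉ K) :
    (1 - p) ^ F.card * P.real A ≤ P.real (A ∩ {ω | ∀ e ∈ F, e ∉ ω}) :=
  Tolerance.pow_mul_real_le_real_inter_forall_notMem P (hP.tolerance_sdiff hp hq) hA hAm hFE hKF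

/-- **`P(A ∩ {F closed}) ≤ (1-π)^{|F|} P(A)`** for a box limit `P = φ^b_{p,q}`. [cite: Grimmett2006, Thm. (4.17)(b) (p. 75); Thm. (3.1)(a) eq. (3.4) (p. 38)] -/
theorem IsBoxLimit.real_inter_forall_notMem_le_pow_mul (hP : IsBoxLimit d b p q P) (hp : p ∈ Set.Icc (0 : ℝ) 1)
    (hq : 1 ≤ q) (hA : DeterminedBy A K) (hAm : MeasurableSet A) {F : Finset (Sym2 (Site d))}
    (hFE : (↑F : Set (Sym2 (Site d))) ⊆ (zdGraph d).edgeSet) (hKF : ∀ e ∈ F, e ∉ K) :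
    P.real (A ∩ {ω | ∀ e ∈ F, e ∉ ω}) ≤ (1 - p / (p + q * (1 - p))) ^ F.card * P.real A := by
  haveI := hP.isProbabilityMeasure
  exact Tolerance.real_inter_forall_notMem_le_pow_mul P (div_insertionDenominator_le_one hp hq)
    (hP.tolerance_union hp hq) hA hAm hFE hKF

/-- **One edge**: `P(A ∩ {e open}) ≤ p · P(A)` for a box limit, `A` measurable determined by `K`, `e ∈ E(ℤ^d) ∖ K`.
[cite: Grimmett2006, Thm. (4.17)(b) (p. 75); Thm. (3.1)(a) eq. (3.4) (p. 38)] -/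
theorem IsBoxLimit.real_inter_mem_le_mul (hP : IsBoxLimit d b p q P) (hp : p ∈ Set.Icc (0 : ℝ) 1) (hq : 1 ≤ q)
    (hA : DeterminedBy A K) (hAm : MeasurableSet A) {e : Sym2 (Site d)} (heE : e ∈ (zdGraph d).edgeSet) (heK : e ∉ K) :
    P.real (A ∩ {ω | e ∈ ω}) ≤ p * P.real A := by
  haveI := hP.isProbabilityMeasure
  exact Tolerance.real_inter_mem_le_mul P (hP.tolerance_sdiff hp hq) hA hAm heE heK

/-- **One edge**: `P(A ∩ {e closed}) ≤ (1 - π) · P(A)` for a box limit, `A` measurable determined by `K`, `e ∈ E(ℤ^d) ∖ K`.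
[cite: Grimmett2006, Thm. (4.17)(b) (p. 75); Thm. (3.1)(a) eq. (3.4) (p. 38)] -/
theorem IsBoxLimit.real_inter_notMem_le_mul (hP : IsBoxLimit d b p q P) (hp : p ∈ Set.Icc (0 : ℝ) 1) (hq : 1 ≤ q)
    (hA : DeterminedBy A K) (hAm : MeasurableSet A) {e : Sym2 (Site d)} (heE : e ∈ (zdGraph d).edgeSet) (heK : e ∉ K) :
    P.real (A ∩ {ω | e ∉ ω}) ≤ (1 - p / (p + q * (1 - p))) * P.real A := by
  haveI := hP.isProbabilityMeasure
  exact Tolerance.real_inter_notMem_le_mul P (hP.tolerance_union hp hq) hA hAm heE heK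

/-! ### Pattern cylinders -/

/-- **Lower pattern bound** `π^{|T|} (1-p)^{|S∖T|} P(A) ≤ P(A ∩ [T]_S)` for a box limit, `S` a finite set of edges of `ℤ^d`
disjoint from `K`, `T ⊆ S`. [cite: Grimmett2006, Thm. (4.17)(b) (p. 75); Thm. (3.1)(a) eq. (3.4) (p. 38)] -/
theorem IsBoxLimit.patternLower_mul_real_le (hP : IsBoxLimit d b p q P) (hp : p ∈ Set.Icc (0 : ℝ) 1) (hq : 1 ≤ q)
    (hA : DeterminedBy A K) (hAm : MeasurableSet A) {S T : Finset (Sym2 (Site d))}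
    (hSE : (↑S : Set (Sym2 (Site d))) ⊆ (zdGraph d).edgeSet) (hKS : ∀ e ∈ S, e ∉ K) (hT : T ⊆ S) :
    (p / (p + q * (1 - p))) ^ T.card * (1 - p) ^ (S \ T).card * P.real A ≤
      P.real (A ∩ localCylinder (↑S : Set (Sym2 (Site d))) ↑T) := by
  classical
  -- `convert`: the generic lemma carries the classical `DecidableEq` instance inside `S \ T`
  convert Tolerance.patternLower_mul_real_le P (div_nonneg hp.1 (insertionDenominator_pos hp hq).le)
    (hP.tolerance_union hp hq) (hP.tolerance_sdiff hp hq) hA hAm hSE hKS hT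

/-- **Upper pattern bound** `P(A ∩ [T]_S) ≤ p^{|T|} (1-π)^{|S∖T|} P(A)` for a box limit. [cite: Grimmett2006, Thm. (4.17)(b) (p. 75); Thm. (3.1)(a) eq. (3.4) (p. 38)] -/
theorem IsBoxLimit.real_inter_localCylinder_le (hP : IsBoxLimit d b p q P) (hp : p ∈ Set.Icc (0 : ℝ) 1) (hq : 1 ≤ q)
    (hA : DeterminedBy A K) (hAm : MeasurableSet A) {S T : Finset (Sym2 (Site d))}
    (hSE : (↑S : Set (Sym2 (Site d))) ⊆ (zdGraph d).edgeSet) (hKS : ∀ e ∈ S, e ∉ K) (hT : T ⊆ S) :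
    P.real (A ∩ localCylinder (↑S : Set (Sym2 (Site d))) ↑T) ≤
      p ^ T.card * (1 - p / (p + q * (1 - p))) ^ (S \ T).card * P.real A := by
  haveI := hP.isProbabilityMeasure
  convert Tolerance.real_inter_localCylinder_le P hp.1 (div_insertionDenominator_le_one hp hq)
    (hP.tolerance_union hp hq) (hP.tolerance_sdiff hp hq) hA hAm hSE hKS hT

/-! ### Quasi-independence of events on and off a finite set of edges -/

/-- **Quasi-independence for `φ^b_{p,q}`, upper half**: for a box limit `P`, `A` measurable determined by `K`, `S` a finite
set of edges of `ℤ^d` disjoint from `K`, `D` determined by `S`: `P(A ∩ D) ≤ q^{|S|} · P(A) P(D)` — the FK form of the `q = 1`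
chain's `P_p(A ∩ D) = P_p(A) P_p(D)` (`bondPercolation_inter_of_disjoint`, `prodBernoulli_real_inter_of_determinedBy`).
[cite: Grimmett2006, Thm. (4.17)(b) (p. 75); Thm. (3.1)(a) eq. (3.4) (p. 38)] -/
theorem IsBoxLimit.real_inter_le_pow_mul_real_mul_real (hP : IsBoxLimit d b p q P) (hp : p ∈ Set.Icc (0 : ℝ) 1)
    (hq : 1 ≤ q) (hA : DeterminedBy A K) (hAm : MeasurableSet A) {S : Finset (Sym2 (Site d))}
    (hSE : (↑S : Set (Sym2 (Site d))) ⊆ (zdGraph d).edgeSet) (hKS : ∀ e ∈ S, e ∉ K) {D : Set (BondConfig (Site d))}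
    (hD : DeterminedBy D (↑S : Set (Sym2 (Site d)))) :
    P.real (A ∩ D) ≤ q ^ S.card * (P.real A * P.real D) := by
  haveI := hP.isProbabilityMeasure
  exact Tolerance.real_inter_le_pow_mul_real_mul_real P (zero_le_one.trans hq)
    (div_nonneg hp.1 (insertionDenominator_pos hp hq).le) (div_insertionDenominator_le_one hp hq) hp.1
    (le_mul_div_insertionDenominator hp hq) (one_sub_div_insertionDenominator_le_mul hp hq)
    (hP.tolerance_union hp hq) (hP.tolerance_sdiff hp hq) hA hAm hSE hKS hD

/-- **Quasi-independence for `φ^b_{p,q}`, lower half**: `P(A) P(D) ≤ q^{|S|} · P(A ∩ D)`. [cite: Grimmett2006, Thm. (4.17)(b) (p. 75); Thm. (3.1)(a) eq. (3.4) (p. 38)] -/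
theorem IsBoxLimit.real_mul_real_le_pow_mul_real_inter (hP : IsBoxLimit d b p q P) (hp : p ∈ Set.Icc (0 : ℝ) 1)
    (hq : 1 ≤ q) (hA : DeterminedBy A K) (hAm : MeasurableSet A) {S : Finset (Sym2 (Site d))}
    (hSE : (↑S : Set (Sym2 (Site d))) ⊆ (zdGraph d).edgeSet) (hKS : ∀ e ∈ S, e ∉ K) {D : Set (BondConfig (Site d))}
    (hD : DeterminedBy D (↑S : Set (Sym2 (Site d)))) :
    P.real A * P.real D ≤ q ^ S.card * P.real (A ∩ D) := by
  haveI := hP.isProbabilityMeasure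
  exact Tolerance.real_mul_real_le_pow_mul_real_inter P (zero_le_one.trans hq)
    (div_nonneg hp.1 (insertionDenominator_pos hp hq).le) (div_insertionDenominator_le_one hp hq) hp.1
    (le_mul_div_insertionDenominator hp hq) (one_sub_div_insertionDenominator_le_mul hp hq)
    (hP.tolerance_union hp hq) (hP.tolerance_sdiff hp hq) hA hAm hSE hKS hD

/-! ### The named limits `rcLimit d b p q = φ^b_{p,q}` -/

/-- **Quasi-independence for `rcLimit d b p q`** (`0 ≤ p ≤ 1`, `q ≥ 1`, both boundary conditions `b`):
`φ^b(A ∩ D) ≤ q^{|S|} φ^b(A) φ^b(D)` for `A` measurable determined by `K`, `D` determined by a finite set `S` of edges of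
`ℤ^d` disjoint from `K`. [cite: Grimmett2006, Thm. (4.17)(b) (p. 75); Thm. (4.19) (p. 77)] -/
theorem rcLimit_real_inter_le_pow_mul_real_mul_real (b : Bool) (hp : p ∈ Set.Icc (0 : ℝ) 1) (hq : 1 ≤ q)
    (hA : DeterminedBy A K) (hAm : MeasurableSet A) {S : Finset (Sym2 (Site d))}
    (hSE : (↑S : Set (Sym2 (Site d))) ⊆ (zdGraph d).edgeSet) (hKS : ∀ e ∈ S, e ∉ K) {D : Set (BondConfig (Site d))}
    (hD : DeterminedBy D (↑S : Set (Sym2 (Site d)))) :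
    (rcLimit d b p q).real (A ∩ D) ≤ q ^ S.card * ((rcLimit d b p q).real A * (rcLimit d b p q).real D) :=
  (isBoxLimit_rcLimit b hp hq).real_inter_le_pow_mul_real_mul_real hp hq hA hAm hSE hKS hD

/-- **Quasi-independence for `rcLimit d b p q`, lower half**: `φ^b(A) φ^b(D) ≤ q^{|S|} φ^b(A ∩ D)`.
[cite: Grimmett2006, Thm. (4.17)(b) (p. 75); Thm. (4.19) (p. 77)] -/
theorem rcLimit_real_mul_real_le_pow_mul_real_inter (b : Bool) (hp : p ∈ Set.Icc (0 : ℝ) 1) (hq : 1 ≤ q)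
    (hA : DeterminedBy A K) (hAm : MeasurableSet A) {S : Finset (Sym2 (Site d))}
    (hSE : (↑S : Set (Sym2 (Site d))) ⊆ (zdGraph d).edgeSet) (hKS : ∀ e ∈ S, e ∉ K) {D : Set (BondConfig (Site d))}
    (hD : DeterminedBy D (↑S : Set (Sym2 (Site d)))) :
    (rcLimit d b p q).real A * (rcLimit d b p q).real D ≤ q ^ S.card * (rcLimit d b p q).real (A ∩ D) :=
  (isBoxLimit_rcLimit b hp hq).real_mul_real_le_pow_mul_real_inter hp hq hA hAm hSE hKS hD

/-- **Two-sided conditional finite energy for `rcLimit d b p q`, open edges**: `π^{|F|} φ^b(A) ≤ φ^b(A ∩ {F open}) ≤ p^{|F|} φ^b(A)`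
for `A` measurable determined by `K` and a finite set `F` of edges of `ℤ^d` disjoint from `K`.
[cite: Grimmett2006, Thm. (4.17)(b) (p. 75); Thm. (4.19) (p. 77)] -/
theorem rcLimit_real_inter_subset_mem_Icc (b : Bool) (hp : p ∈ Set.Icc (0 : ℝ) 1) (hq : 1 ≤ q)
    (hA : DeterminedBy A K) (hAm : MeasurableSet A) {F : Finset (Sym2 (Site d))}
    (hFE : (↑F : Set (Sym2 (Site d))) ⊆ (zdGraph d).edgeSet) (hKF : ∀ e ∈ F, e ∉ K) :
    (rcLimit d b p q).real (A ∩ {ω | (↑F : Set (Sym2 (Site d))) ⊆ ω}) ∈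
      Set.Icc ((p / (p + q * (1 - p))) ^ F.card * (rcLimit d b p q).real A) (p ^ F.card * (rcLimit d b p q).real A) :=
  ⟨(isBoxLimit_rcLimit b hp hq).pow_mul_real_le_real_inter_subset hp hq hA hAm hFE hKF,
    (isBoxLimit_rcLimit b hp hq).real_inter_subset_le_pow_mul hp hq hA hAm hFE hKF⟩

/-- **Two-sided conditional finite energy for `rcLimit d b p q`, closed edges**:
`(1-p)^{|F|} φ^b(A) ≤ φ^b(A ∩ {F closed}) ≤ (1-π)^{|F|} φ^b(A)`. [cite: Grimmett2006, Thm. (4.17)(b) (p. 75); Thm. (4.19) (p. 77)] -/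
theorem rcLimit_real_inter_forall_notMem_mem_Icc (b : Bool) (hp : p ∈ Set.Icc (0 : ℝ) 1) (hq : 1 ≤ q)
    (hA : DeterminedBy A K) (hAm : MeasurableSet A) {F : Finset (Sym2 (Site d))}
    (hFE : (↑F : Set (Sym2 (Site d))) ⊆ (zdGraph d).edgeSet) (hKF : ∀ e ∈ F, e ∉ K) :
    (rcLimit d b p q).real (A ∩ {ω | ∀ e ∈ F, e ∉ ω}) ∈
      Set.Icc ((1 - p) ^ F.card * (rcLimit d b p q).real A)
        ((1 - p / (p + q * (1 - p))) ^ F.card * (rcLimit d b p q).real A) :=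
  ⟨(isBoxLimit_rcLimit b hp hq).pow_mul_real_le_real_inter_forall_notMem hp hq hA hAm hFE hKF,
    (isBoxLimit_rcLimit b hp hq).real_inter_forall_notMem_le_pow_mul hp hq hA hAm hFE hKF⟩

end Summit.CriticalPhenomena.PercolationContinuityZ3.Theorems.FK

end
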